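import Summits.QuantumFields.YangMills.Theorems.FluctuationComparisonRegPrIntLS2BetaRhoAColumnCovers
import Summits.QuantumFields.YangMills.Theorems.FluctuationComparisonRegPrIntLS2BetaLiftLadderDiscRowTower
import Summits.QuantumFields.YangMills.Theorems.FluctuationComparisonRegPrIntLS2BetaPeanoSmooth
import HarnessLib

/-!
# S2β · THE SUP CHAIN ∕ (D-stage) — THE `ρA` COLUMN, PART 3: THE BUDGET `Σ_{t<K−J} L^t·Σ_B ρA(t,B)² ≤ C_A·e^{c·Σθ′}·purse + β_A·S′` FROM px10's (k1) budget one level up,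
# the fibre mate (E4) and the parent READ′ energy (✓(k2′) + ✓`mShare_le`) — `C_A := L⁻⁴·4L·C_P`, `β_A := L⁻⁴·(4L·β_P + 1536(2σM)²(1+σM²∕3)²·(2d·13^d)·L)`

Cell `ym3-torus` (YM ladder rung R3 = continuum `SU(2)` Yang–Mills on the three-torus at fixed lattice data — a RUNG: NOT d = 4, NOT infinite volume,
NOT a mass gap, NOT Clay).  Width seat «width 21» `ym3-torus-px21` (gen 25), FREE px helper on crux `stmt-QuantumFields-20520`
(`…Theses.UnitScaleTilt.FluctuationComparisonRegPrIntL`), LINE g18-1 S2β.  px12 g26 2026-08-31 23:15:14Z: «the ρA column is yours to assemble» — ρA-1 (object + P's `hρA`),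
ρA-2 (the parent box sups are read), ρA-3 = THIS (the arithmetic).  `--kind proof --supports stmt-QuantumFields-20520 --as helper`, count-neutral, DEFINITION-FREE
(0 `def`, 0 `instance`, 0 `notation`, 0 `sorry`, default heartbeats).

WHAT IS PROVED (sorry-free).  `sq_sqrt_rhoA_le` (one real step), ★★★`rhoA_column_budget (hJK) (U₀ ζ wt) (hwt) (hmate) (θ σ) (hσ0 hσM) (hPk1)` — conclusion in the common column
currency of ✓p836415 (α) ∕ δ ∕ (η): `Σ_{t∈range(K−J)} L^t·Σ_B (ρA t B)² ≤ C_A·exp(c·Σθ′)·purse + β_A·S′` with ρA-1's EXPLICIT dite'd `ρA`, the (k1) budget `hPk1` in px10 g26's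
own currency (✓`hP_of_chartTower`'s conclusion shape, `ρP₁₀(t,B)` = the thickness-`2L+1` read-cell sup), and INSIDE by name: ρA-2 `rhoPpar_le_readCellParent` (+ index shift
`t = t′+1`: the parent (k1) cell IS `ρP₁₀(t′,B)` after `K−(J+(t′+2))+1 = K−(J+(t′+1))`; the `t = 0` term vanishes: (E4) `hmate` + ✓`iter_eq_of_descendTo_eq` + ρA-2
`piSup_relPlaq_eq_zero_of_eq`), ρA-2 `mCpar_le_parentBoxSup` + ✓p837136 `sum_sq_parentBoxSup_le_readSup J t 3 η_{J+t}` + px20's ✓`mShare_le`.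

HONEST SCOPE.  Real bookkeeping over landed letters; `hPk1`, `hwt`, `hmate`, the arcs are HYPOTHESES; nothing of Bałaban's renormalisation-group analysis is asserted or
proved ([Balaban1985Averaging] Prop. 4 (128)–(135) pp.37–38; [Balaban1985RegularSpaces] (1.29) p.81; [Balaban1987RG1] (0.3)–(0.4), (0.11) pp.252–253); the ρ̃-column
budget's other columns (ρS, mA, sizes), (SRC-P), `hArc`, (ST⁗)∕LOC⁗, GAP♯∘ (`stub_uniformFibreGapOrbit`, registry 3732b7df UNTOUCHED), the five registered stubs (0∕5), S2β,
20520, 19936, 19200, `YM3TorusSU2` are NOT proved; no registered stub is closed; rung R3 — NOT d = 4, NOT infinite volume, NOT a mass gap, NOT Clay; the Yang–Mills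
mass gap is NOT proved.
-/

set_option autoImplicit false

namespace Summit.QuantumFields.YangMills.Theorems.FluctuationComparisonRegPrIntLS2BetaRhoAColumnBudget

open Finset
open scoped Real
open Literature.MathematicalPhysics.QuantumLattice (su2Quat)
open Literature.MathematicalPhysics.QuantumFieldTheory.Balaban1983to89
open T4Continuum T3ContinuumYM3Torus T3TiltDescent T3LevelShift BlockAveraging
open B10Eq27TorusAxialLog (rel rel_apply rel_self)
open B14.Eq22Determines (blockIter)
open T4CubeChartGnomonic (SU2)
open T4HaarSU2ExpChart (expPoint)
open T4ExpWindowSmallField (logVec)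
open T3UnitLawDensityEML (ℰp)
open Summit.QuantumFields.YangMills.Theorems.FluctuationComparisonRegPrIntLS2BetaLiftLadderDiscRowTower (mShare_le)
open Summit.QuantumFields.YangMills.Theorems.FluctuationComparisonRegPrIntLS2BetaPeanoSmooth (iter_eq_of_descendTo_eq)
open Summit.QuantumFields.YangMills.Theorems.FluctuationComparisonRegPrIntLS2BetaParentBoxReadCover (sum_sq_parentBoxSup_le_readSup)
open Summit.QuantumFields.YangMills.Theorems.FluctuationComparisonRegPrIntLS2BetaRhoAColumnCovers (mCpar_le_parentBoxSup rhoPpar_le_readCellParent piSup_relPlaq_eq_zero_of_eq)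

section Tower

variable {F : T3Family}

/-- One real step: `(√X)² = X` and `σ_t ≤ σM` monotonicity of the lift-curvature weight. [folklore] -/
theorem sq_sqrt_rhoA_le (Li ρ m σt σM : ℝ) (hσ0 : 0 ≤ σt) (hσM : σt ≤ σM) :
    Real.sqrt ((Li) ^ 2 * (Li) ^ 2 * (4 * ρ ^ 2 + 1536 * (σt + σt) ^ 2 * ((1 + σt ^ 2 / 3) * m) ^ 2)) ^ 2 ≤
      ((Li) ^ 2 * (Li) ^ 2) * (4 * ρ ^ 2 + (1536 * (σM + σM) ^ 2 * (1 + σM ^ 2 / 3) ^ 2) * m ^ 2) := by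
  rw [Real.sq_sqrt (by positivity)]
  have h1 : (σt + σt) ^ 2 ≤ (σM + σM) ^ 2 := pow_le_pow_left₀ (by linarith) (by linarith) 2
  have h2 : (1 + σt ^ 2 / 3) ^ 2 ≤ (1 + σM ^ 2 / 3) ^ 2 :=
    pow_le_pow_left₀ (by positivity) (by nlinarith [pow_le_pow_left₀ hσ0 hσM 2]) 2
  have h3 : (σt + σt) ^ 2 * ((1 + σt ^ 2 / 3) * m) ^ 2 ≤ (σM + σM) ^ 2 * (1 + σM ^ 2 / 3) ^ 2 * m ^ 2 := by
    rw [mul_pow, ← mul_assoc]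
    exact mul_le_mul_of_nonneg_right (mul_le_mul h1 h2 (by positivity) (by positivity)) (sq_nonneg m)
  have hL : 0 ≤ (Li) ^ 2 * (Li) ^ 2 := by positivity
  nlinarith [mul_le_mul_of_nonneg_left h3 hL]

set_option maxHeartbeats 400000 in
/-- ★★★ **THE `ρA`-COLUMN BUDGET** (ρA-3): with ✓∕⧗ρA-1's explicit `ρA t B := if ht then √(L⁻⁴·(4ρP_par² + 1536(2σ_t)²((1+σ_t²∕3)mC_par)²)) else 0`,
**`Σ_{t<K−J} L^t·Σ_B ρA(t,B)² ≤ C_A·exp(c·Σθ′)·purse + β_A·S′`** with `C_A := L⁻⁴·4L·C_P`, `β_A := L⁻⁴·(4L·β_P + 1536(2σM)²(1+σM²∕3)²·(2d·13^d)·L)` — FROM px10 g26's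
(k1) budget in its own currency `hPk1 : Σ_t L^t·Σ_B ρP₁₀(t,B)² ≤ C_P·exp(c·Σθ′)·purse + β_P·S′` (✓`hP_of_chartTower`'s shape), the fibre mate (E4) `hmate` (the `t = 0` parent
term vanishes), the hat weights `hwt` and per-level parent arcs `0 ≤ σ t ≤ σM`.  INSIDE by name: ✓∕⧗ρA-2 `rhoPpar_le_readCellParent` + the index shift `t = t′+1` (the (k1) cell at
the parent height IS `ρP₁₀(t−1,B)`), ✓∕⧗ρA-2 `mCpar_le_parentBoxSup` + ✓p837136 (k2′) at `r = 3` + px20's ✓`mShare_le`.  `purse`∕`Σθ′`∕`S′`∕`M` = the station's texts VERBATIM.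
(Heartbeats: the statement carries five letter-sized station texts; it elaborates at the default 200 000 but FAILS at 150 000 and 175 000 — inside the README cliff band —
so a decl-local `maxHeartbeats 400000` is carried as insurance, README HEARTBEAT-BUDGET form, exactly as the station ✓p834059 and the knits.)
[cite: Balaban1985Averaging, Prop. 4 (128)-(135) p.37-38; Balaban1985RegularSpaces, (1.29) p.81; Balaban1987RG1, (0.3)-(0.4), (0.11) p.252-253] -/
theorem rhoA_column_budget {J K : ℕ} (hJK : J ≤ K) (U₀ : GaugeField (F.P K) 0 (Matrix.specialUnitaryGroup (Fin 2) ℂ)) (ζ : PBond (F.P K) 0 → EuclideanSpace ℝ (Fin 3))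
    (wt : (j : ℕ) → PBond (F.P K) j → PBond (F.P K) (j + 1) → ℝ)
    (hwt : ∀ j b e, wt j b e = if e.dir = b.dir ∧ (b.src b.dir - emb e.src b.dir).val < (F.P K).L then
        ∏ ν ∈ Finset.univ.erase b.dir, max 0 (1 - ((rel (emb e.src) b.src ν).natAbs : ℝ) / (F.P K).L) else 0)
    (hmate : descendTo F ℰp J K hJK (fun ℓ => expPoint (ζ ℓ) * U₀ ℓ : GaugeField (F.P K) 0 (Matrix.specialUnitaryGroup (Fin 2) ℂ)) = descendTo F ℰp J K hJK U₀)
    (θ : ℕ → ℝ) (σ : ℕ → ℝ) {σM : ℝ} (hσ0 : ∀ t, 0 ≤ σ t) (hσM : ∀ t, σ t ≤ σM) {C_P β_P c : ℝ}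
    (hPk1 : ∑ t ∈ Finset.range (K - J), (F.L : ℝ) ^ t * ∑ B : PBond (F.P J) 0, ‖(fun q : Plaq (F.P K) (K - (J + (t + 1))) =>
        if ∃ z₀ : Site (F.P K) 0, (blockIter (K - J) z₀ = (bondShift (F.sitesPerDir_eq (m := F.m) (K := J) (j := 0) (m' := F.m) (K' := K) (j' := K - J) (by omega)) B).src ∨
            blockIter (K - J) z₀ = (bondShift (F.sitesPerDir_eq (m := F.m) (K := J) (j := 0) (m' := F.m) (K' := K) (j' := K - J) (by omega)) B).tgt) ∧
            ∀ κ, (rel (blockIter (K - (J + (t + 1))) z₀) q.src κ).natAbs ≤ 2 * F.L + 1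
        then dist1 ((GaugeField.plaqHol (Averaging.iter (fun k => BlockAveraging.blockAvg (P := F.P K) (j := k) ℰp) (K - (J + (t + 1))) U₀) q)⁻¹ *
          GaugeField.plaqHol (Averaging.iter (fun k => BlockAveraging.blockAvg (P := F.P K) (j := k) ℰp) (K - (J + (t + 1)))
            (fun ℓ => expPoint (ζ ℓ) * U₀ ℓ : GaugeField (F.P K) 0 (Matrix.specialUnitaryGroup (Fin 2) ℂ))) q)
        else 0)‖ ^ 2 ≤ C_P * Real.exp (c * ∑ i ∈ Finset.range (K - J), (((5 * F.L : ℕ) : ℝ) ^ 2 / 4) * θ (K - i)) * (((F.L : ℝ)⁻¹) ^ (K - J) * ∑ ℓ : PBond (F.P K) 0, ‖ζ ℓ‖ ^ 2 +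
                (F.L : ℝ) ^ (K - J) * ∑ p : Plaq (F.P K) 0,
                  (1 - reTr ((GaugeField.plaqHol U₀ p)⁻¹ * GaugeField.plaqHol (fun ℓ => expPoint (ζ ℓ) * U₀ ℓ : GaugeField (F.P K) 0 (Matrix.specialUnitaryGroup (Fin 2) ℂ)) p))) +
      β_P * (∑ t ∈ Finset.range (K - J), (if ht : t < K - J then
          (F.L : ℝ) ^ t * ∑ B : PBond (F.P J) 0,
            ‖(fun ℓ' : PBond (F.P (J + (t + 1))) 0 =>
              if ∃ z : Site (F.P (J + (t + 1))) 0,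
                (B14.Eq22Determines.blockIter (t + 1) z = (bondShift (F.sitesPerDir_eq (m := F.m) (K := J) (j := 0) (m' := F.m) (K' := J + (t + 1)) (j' := t + 1) (by omega)) B).src ∨ B14.Eq22Determines.blockIter (t + 1) z = (bondShift (F.sitesPerDir_eq (m := F.m) (K := J) (j := 0) (m' := F.m) (K' := J + (t + 1)) (j' := t + 1) (by omega)) B).tgt) ∧
                ∀ ν, (B10Eq27TorusAxialLog.rel z ℓ'.src ν).natAbs ≤ 2
              then logVec (su2Quat (descendTo F ℰp (J + (t + 1)) K (by omega) (fun ℓ => expPoint (ζ ℓ) * U₀ ℓ : GaugeField (F.P K) 0 (Matrix.specialUnitaryGroup (Fin 2) ℂ)) ℓ' * (descendTo F ℰp (J + (t + 1)) K (by omega) U₀ ℓ')⁻¹)) else 0)‖ ^ 2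
        else 0))) :
    ∑ t ∈ Finset.range (K - J), (F.L : ℝ) ^ t * ∑ B : PBond (F.P J) 0, ((fun (t : ℕ) (B : PBond (F.P J) 0) => if ht : t < K - J then Real.sqrt (((((F.P K).L : ℕ) : ℝ)⁻¹) ^ 2 * ((((F.P K).L : ℕ) : ℝ)⁻¹) ^ 2 * (4 * ‖(fun p : Plaq (F.P K) ((K - (J + (t + 1))) + 1) => if (∃ q : Plaq (F.P K) (K - (J + (t + 1))), ((∃ ℓ' : PBond (F.P (J + (t + 1))) 0, (∃ z : Site (F.P (J + (t + 1))) 0,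
                (B14.Eq22Determines.blockIter (t + 1) z = (bondShift (F.sitesPerDir_eq (m := F.m) (K := J) (j := 0) (m' := F.m) (K' := J + (t + 1)) (j' := t + 1) (by omega)) B).src ∨ B14.Eq22Determines.blockIter (t + 1) z = (bondShift (F.sitesPerDir_eq (m := F.m) (K := J) (j := 0) (m' := F.m) (K' := J + (t + 1)) (j' := t + 1) (by omega)) B).tgt) ∧
                ∀ ν, (B10Eq27TorusAxialLog.rel z ℓ'.src ν).natAbs ≤ 2) ∧
        (blockOf q.src = blockOf (bondShift (F.sitesPerDir_eq (m := F.m) (K := J + (t + 1)) (j := 0) (m' := F.m) (K' := K) (j' := (K - (J + (t + 1)))) (by omega)) ℓ').src ∨ blockOf q.src = (blockOf (bondShift (F.sitesPerDir_eq (m := F.m) (K := J + (t + 1)) (j := 0) (m' := F.m) (K' := K) (j' := (K - (J + (t + 1)))) (by omega)) ℓ').src).shift (bondShift (F.sitesPerDir_eq (m := F.m) (K := J + (t + 1)) (j := 0) (m' := F.m) (K' := K) (j' := (K - (J + (t + 1)))) (by omega)) ℓ').dir))) ∧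
          (if (q.src q.μ - emb p.src q.μ).val < (F.P K).L then (1 : ℝ) else 0) *
          (∏ ι ∈ (Finset.univ.erase q.μ).erase q.ν, max 0 (1 - ((rel (emb p.src) q.src ι).natAbs : ℝ) / (F.P K).L)) *
          (if (q.src q.ν - emb p.src q.ν).val < (F.P K).L then (1 : ℝ) else 0) ≠ 0 ∧ p.μ = q.μ ∧ p.ν = q.ν) then dist1 ((GaugeField.plaqHol (Averaging.iter (fun k => blockAvg (P := F.P K) (j := k) ℰp) ((K - (J + (t + 1))) + 1) U₀) p)⁻¹ * GaugeField.plaqHol (Averaging.iter (fun k => blockAvg (P := F.P K) (j := k) ℰp) ((K - (J + (t + 1))) + 1) (fun ℓ => expPoint (ζ ℓ) * U₀ ℓ : GaugeField (F.P K) 0 (Matrix.specialUnitaryGroup (Fin 2) ℂ))) p) else 0)‖ ^ 2 + 1536 * (σ t + σ t) ^ 2 * ((1 + σ t ^ 2 / 3) * ‖(fun e : PBond (F.P K) ((K - (J + (t + 1))) + 1) => if (∃ q : Plaq (F.P K) (K - (J + (t + 1))), ((∃ ℓ' : PBond (F.P (J + (t + 1))) 0, (∃ z : Site (F.P (J + (t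 + 1))) 0,
                (B14.Eq22Determines.blockIter (t + 1) z = (bondShift (F.sitesPerDir_eq (m := F.m) (K := J) (j := 0) (m' := F.m) (K' := J + (t + 1)) (j' := t + 1) (by omega)) B).src ∨ B14.Eq22Determines.blockIter (t + 1) z = (bondShift (F.sitesPerDir_eq (m := F.m) (K := J) (j := 0) (m' := F.m) (K' := J + (t + 1)) (j' := t + 1) (by omega)) B).tgt) ∧
                ∀ ν, (B10Eq27TorusAxialLog.rel z ℓ'.src ν).natAbs ≤ 2) ∧
        (blockOf q.src = blockOf (bondShift (F.sitesPerDir_eq (m := F.m) (K := J + (t + 1)) (j := 0) (m' := F.m) (K' := K) (j' := (K - (J + (t + 1)))) (by omega)) ℓ').src ∨ blockOf q.src = (blockOf (bondShift (F.sitesPerDir_eq (m := F.m) (K := J + (t + 1)) (j := 0) (m' := F.m) (K' := K) (j' := (K - (J + (t + 1)))) (by omega)) ℓ').src).shift (bondShift (F.sitesPerDir_eq (m := F.m) (K := J + (t + 1)) (j := 0) (m' := F.m) (K' := K) (j' := (K - (J + (t + 1)))) (by omega)) ℓ').dir))) ∧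
          ((∃ y : Site (F.P K) ((K - (J + (t + 1))) + 1), (if (q.src q.μ - emb y q.μ).val < (F.P K).L then (1 : ℝ) else 0) *
          (∏ ι ∈ (Finset.univ.erase q.μ).erase q.ν, max 0 (1 - ((rel (emb y) q.src ι).natAbs : ℝ) / (F.P K).L)) *
          (if (q.src q.ν - emb y q.ν).val < (F.P K).L then (1 : ℝ) else 0) ≠ 0 ∧ (e = ⟨y, q.μ⟩ ∨ e = ⟨y.shift q.μ, q.ν⟩ ∨ e = ⟨y.shift q.ν, q.μ⟩ ∨ e = ⟨y, q.ν⟩)) ∨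
           (∃ b : PBond (F.P K) (K - (J + (t + 1))), (b = ⟨q.src, q.μ⟩ ∨ b = ⟨q.src.shift q.μ, q.ν⟩ ∨ b = ⟨q.src.shift q.ν, q.μ⟩ ∨ b = ⟨q.src, q.ν⟩) ∧ wt (K - (J + (t + 1))) b e ≠ 0))) then dist1 ((Averaging.iter (fun k => blockAvg (P := F.P K) (j := k) ℰp) ((K - (J + (t + 1))) + 1) (fun ℓ => expPoint (ζ ℓ) * U₀ ℓ : GaugeField (F.P K) 0 (Matrix.specialUnitaryGroup (Fin 2) ℂ))) e * ((Averaging.iter (fun k => blockAvg (P := F.P K) (j := k) ℰp) ((K - (J + (t + 1))) + 1) U₀) e)⁻¹) else 0)‖) ^ 2)) else 0) t B) ^ 2 ≤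
      ((((((F.P K).L : ℕ) : ℝ)⁻¹) ^ 2 * ((((F.P K).L : ℕ) : ℝ)⁻¹) ^ 2) * (4 * (F.L : ℝ)) * C_P) * Real.exp (c * ∑ i ∈ Finset.range (K - J), (((5 * F.L : ℕ) : ℝ) ^ 2 / 4) * θ (K - i)) * (((F.L : ℝ)⁻¹) ^ (K - J) * ∑ ℓ : PBond (F.P K) 0, ‖ζ ℓ‖ ^ 2 +
                (F.L : ℝ) ^ (K - J) * ∑ p : Plaq (F.P K) 0,
                  (1 - reTr ((GaugeField.plaqHol U₀ p)⁻¹ * GaugeField.plaqHol (fun ℓ => expPoint (ζ ℓ) * U₀ ℓ : GaugeField (F.P K) 0 (Matrix.specialUnitaryGroup (Fin 2) ℂ)) p))) +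
      ((((((F.P K).L : ℕ) : ℝ)⁻¹) ^ 2 * ((((F.P K).L : ℕ) : ℝ)⁻¹) ^ 2) * (4 * (F.L : ℝ) * β_P + (1536 * (σM + σM) ^ 2 * (1 + σM ^ 2 / 3) ^ 2) * ((2 * (F.P J).d * (2 * (3 + 3) + 1) ^ (F.P J).d : ℕ) : ℝ) * (F.L : ℝ))) * (∑ t ∈ Finset.range (K - J), (if ht : t < K - J then
          (F.L : ℝ) ^ t * ∑ B : PBond (F.P J) 0,
            ‖(fun ℓ' : PBond (F.P (J + (t + 1))) 0 =>
              if ∃ z : Site (F.P (J + (t + 1))) 0,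
                (B14.Eq22Determines.blockIter (t + 1) z = (bondShift (F.sitesPerDir_eq (m := F.m) (K := J) (j := 0) (m' := F.m) (K' := J + (t + 1)) (j' := t + 1) (by omega)) B).src ∨ B14.Eq22Determines.blockIter (t + 1) z = (bondShift (F.sitesPerDir_eq (m := F.m) (K := J) (j := 0) (m' := F.m) (K' := J + (t + 1)) (j' := t + 1) (by omega)) B).tgt) ∧
                ∀ ν, (B10Eq27TorusAxialLog.rel z ℓ'.src ν).natAbs ≤ 2
              then logVec (su2Quat (descendTo F ℰp (J + (t + 1)) K (by omega) (fun ℓ => expPoint (ζ ℓ) * U₀ ℓ : GaugeField (F.P K) 0 (Matrix.specialUnitaryGroup (Fin 2) ℂ)) ℓ' * (descendTo F ℰp (J + (t + 1)) K (by omega) U₀ ℓ')⁻¹)) else 0)‖ ^ 2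
        else 0)) := by
  classical
  have hLI : (0 : ℝ) ≤ (((((F.P K).L : ℕ) : ℝ)⁻¹) ^ 2 * ((((F.P K).L : ℕ) : ℝ)⁻¹) ^ 2) := by positivity
  have hCS : (0 : ℝ) ≤ (1536 * (σM + σM) ^ 2 * (1 + σM ^ 2 / 3) ^ 2) := by positivity
  have hCA3 : (0 : ℝ) ≤ ((2 * (F.P J).d * (2 * (3 + 3) + 1) ^ (F.P J).d : ℕ) : ℝ) := by positivity
  have hLr : (0 : ℝ) ≤ (F.L : ℝ) := by positivity
  -- STEP 1 (per level): the ρA row against the two parent currencies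
  have hlev : ∀ t ∈ Finset.range (K - J),
      (F.L : ℝ) ^ t * ∑ B : PBond (F.P J) 0, ((fun (t : ℕ) (B : PBond (F.P J) 0) => if ht : t < K - J then Real.sqrt (((((F.P K).L : ℕ) : ℝ)⁻¹) ^ 2 * ((((F.P K).L : ℕ) : ℝ)⁻¹) ^ 2 * (4 * ‖(fun p : Plaq (F.P K) ((K - (J + (t + 1))) + 1) => if (∃ q : Plaq (F.P K) (K - (J + (t + 1))), ((∃ ℓ' : PBond (F.P (J + (t + 1))) 0, (∃ z : Site (F.P (J + (t + 1))) 0,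
                (B14.Eq22Determines.blockIter (t + 1) z = (bondShift (F.sitesPerDir_eq (m := F.m) (K := J) (j := 0) (m' := F.m) (K' := J + (t + 1)) (j' := t + 1) (by omega)) B).src ∨ B14.Eq22Determines.blockIter (t + 1) z = (bondShift (F.sitesPerDir_eq (m := F.m) (K := J) (j := 0) (m' := F.m) (K' := J + (t + 1)) (j' := t + 1) (by omega)) B).tgt) ∧
                ∀ ν, (B10Eq27TorusAxialLog.rel z ℓ'.src ν).natAbs ≤ 2) ∧
        (blockOf q.src = blockOf (bondShift (F.sitesPerDir_eq (m := F.m) (K := J + (t + 1)) (j := 0) (m' := F.m) (K' := K) (j' := (K - (J + (t + 1)))) (by omega)) ℓ').src ∨ blockOf q.src = (blockOf (bondShift (F.sitesPerDir_eq (m := F.m) (K := J + (t + 1)) (j := 0) (m' := F.m) (K' := K) (j' := (K - (J + (t + 1)))) (by omega)) ℓ').src).shift (bondShift (F.sitesPerDir_eq (m := F.m) (K := J + (t + 1)) (j := 0) (m' := F.m) (K' := K) (j' := (K - (J + (t + 1)))) (by omega)) ℓ').dir))) ∧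
          (if (q.src q.μ - emb p.src q.μ).val < (F.P K).L then (1 : ℝ) else 0) *
          (∏ ι ∈ (Finset.univ.erase q.μ).erase q.ν, max 0 (1 - ((rel (emb p.src) q.src ι).natAbs : ℝ) / (F.P K).L)) *
          (if (q.src q.ν - emb p.src q.ν).val < (F.P K).L then (1 : ℝ) else 0) ≠ 0 ∧ p.μ = q.μ ∧ p.ν = q.ν) then dist1 ((GaugeField.plaqHol (Averaging.iter (fun k => blockAvg (P := F.P K) (j := k) ℰp) ((K - (J + (t + 1))) + 1) U₀) p)⁻¹ * GaugeField.plaqHol (Averaging.iter (fun k => blockAvg (P := F.P K) (j := k) ℰp) ((K - (J + (t + 1))) + 1) (fun ℓ => expPoint (ζ ℓ) * U₀ ℓ : GaugeField (F.P K) 0 (Matrix.specialUnitaryGroup (Fin 2) ℂ))) p) else 0)‖ ^ 2 + 1536 * (σ t + σ t) ^ 2 * ((1 + σ t ^ 2 / 3) * ‖(fun e : PBond (F.P K) ((K - (J + (t + 1))) + 1) => if (∃ q : Plaq (F.P K) (K - (J + (t + 1))), ((∃ ℓ' : PBond (F.P (J + (t + 1))) 0, (∃ z : Site (F.P (J + (t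 + 1))) 0,
                (B14.Eq22Determines.blockIter (t + 1) z = (bondShift (F.sitesPerDir_eq (m := F.m) (K := J) (j := 0) (m' := F.m) (K' := J + (t + 1)) (j' := t + 1) (by omega)) B).src ∨ B14.Eq22Determines.blockIter (t + 1) z = (bondShift (F.sitesPerDir_eq (m := F.m) (K := J) (j := 0) (m' := F.m) (K' := J + (t + 1)) (j' := t + 1) (by omega)) B).tgt) ∧
                ∀ ν, (B10Eq27TorusAxialLog.rel z ℓ'.src ν).natAbs ≤ 2) ∧
        (blockOf q.src = blockOf (bondShift (F.sitesPerDir_eq (m := F.m) (K := J + (t + 1)) (j := 0) (m' := F.m) (K' := K) (j' := (K - (J + (t + 1)))) (by omega)) ℓ').src ∨ blockOf q.src = (blockOf (bondShift (F.sitesPerDir_eq (m := F.m) (K := J + (t + 1)) (j := 0) (m' := F.m) (K' := K) (j' := (K - (J + (t + 1)))) (by omega)) ℓ').src).shift (bondShift (F.sitesPerDir_eq (m := F.m) (K := J + (t + 1)) (j := 0) (m' := F.m) (K' := K) (j' := (K - (J + (t + 1)))) (by omega)) ℓ').dir))) ∧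
          ((∃ y : Site (F.P K) ((K - (J + (t + 1))) + 1), (if (q.src q.μ - emb y q.μ).val < (F.P K).L then (1 : ℝ) else 0) *
          (∏ ι ∈ (Finset.univ.erase q.μ).erase q.ν, max 0 (1 - ((rel (emb y) q.src ι).natAbs : ℝ) / (F.P K).L)) *
          (if (q.src q.ν - emb y q.ν).val < (F.P K).L then (1 : ℝ) else 0) ≠ 0 ∧ (e = ⟨y, q.μ⟩ ∨ e = ⟨y.shift q.μ, q.ν⟩ ∨ e = ⟨y.shift q.ν, q.μ⟩ ∨ e = ⟨y, q.ν⟩)) ∨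
           (∃ b : PBond (F.P K) (K - (J + (t + 1))), (b = ⟨q.src, q.μ⟩ ∨ b = ⟨q.src.shift q.μ, q.ν⟩ ∨ b = ⟨q.src.shift q.ν, q.μ⟩ ∨ b = ⟨q.src, q.ν⟩) ∧ wt (K - (J + (t + 1))) b e ≠ 0))) then dist1 ((Averaging.iter (fun k => blockAvg (P := F.P K) (j := k) ℰp) ((K - (J + (t + 1))) + 1) (fun ℓ => expPoint (ζ ℓ) * U₀ ℓ : GaugeField (F.P K) 0 (Matrix.specialUnitaryGroup (Fin 2) ℂ))) e * ((Averaging.iter (fun k => blockAvg (P := F.P K) (j := k) ℰp) ((K - (J + (t + 1))) + 1) U₀) e)⁻¹) else 0)‖) ^ 2)) else 0) t B) ^ 2 ≤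
        (((((F.P K).L : ℕ) : ℝ)⁻¹) ^ 2 * ((((F.P K).L : ℕ) : ℝ)⁻¹) ^ 2) * (4 * ((F.L : ℝ) ^ t * ∑ B : PBond (F.P J) 0, ‖(fun p : Plaq (F.P K) ((K - (J + (t + 1))) + 1) => if ∃ z₀ : Site (F.P K) 0, (B14.Eq22Determines.blockIter (K - J) z₀ = (bondShift (F.sitesPerDir_eq (m := F.m) (K := J) (j := 0) (m' := F.m) (K' := K) (j' := K - J) (by omega)) B).src ∨
            B14.Eq22Determines.blockIter (K - J) z₀ = (bondShift (F.sitesPerDir_eq (m := F.m) (K := J) (j := 0) (m' := F.m) (K' := K) (j' := K - J) (by omega)) B).tgt) ∧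
            ∀ κ, (rel (B14.Eq22Determines.blockIter ((K - (J + (t + 1))) + 1) z₀) p.src κ).natAbs ≤ 2 * F.L + 1 then dist1 ((GaugeField.plaqHol (Averaging.iter (fun k => blockAvg (P := F.P K) (j := k) ℰp) ((K - (J + (t + 1))) + 1) U₀) p)⁻¹ * GaugeField.plaqHol (Averaging.iter (fun k => blockAvg (P := F.P K) (j := k) ℰp) ((K - (J + (t + 1))) + 1) (fun ℓ => expPoint (ζ ℓ) * U₀ ℓ : GaugeField (F.P K) 0 (Matrix.specialUnitaryGroup (Fin 2) ℂ))) p) else 0)‖ ^ 2) +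
          (1536 * (σM + σM) ^ 2 * (1 + σM ^ 2 / 3) ^ 2) * (((2 * (F.P J).d * (2 * (3 + 3) + 1) ^ (F.P J).d : ℕ) : ℝ) * ((F.L : ℝ) ^ t * (if ht : t < K - J then
          ∑ B : PBond (F.P J) 0,
            ‖(fun ℓ' : PBond (F.P (J + t)) 0 =>
              if ∃ z : Site (F.P (J + t)) 0,
                (B14.Eq22Determines.blockIter t z = (bondShift (F.sitesPerDir_eq (m := F.m) (K := J) (j := 0) (m' := F.m) (K' := J + t) (j' := t) (by omega)) B).src ∨ B14.Eq22Determines.blockIter t z = (bondShift (F.sitesPerDir_eq (m := F.m) (K := J) (j := 0) (m' := F.m) (K' := J + t) (j' := t) (by omega)) B).tgt) ∧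
                ∀ ν, (B10Eq27TorusAxialLog.rel z ℓ'.src ν).natAbs ≤ 2
              then logVec (su2Quat (descendTo F ℰp (J + t) K (by omega) (fun ℓ => expPoint (ζ ℓ) * U₀ ℓ : GaugeField (F.P K) 0 (Matrix.specialUnitaryGroup (Fin 2) ℂ)) ℓ' * (descendTo F ℰp (J + t) K (by omega) U₀ ℓ')⁻¹)) else 0)‖ ^ 2
        else 0)))) := by
    intro t hmem
    have ht : t < K - J := Finset.mem_range.mp hmem
    have hLt : (0 : ℝ) ≤ (F.L : ℝ) ^ t := by positivity
    simp only [dif_pos ht]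
    -- per `B`
    have hB : ∀ B : PBond (F.P J) 0, (Real.sqrt (((((F.P K).L : ℕ) : ℝ)⁻¹) ^ 2 * ((((F.P K).L : ℕ) : ℝ)⁻¹) ^ 2 * (4 * ‖(fun p : Plaq (F.P K) ((K - (J + (t + 1))) + 1) => if (∃ q : Plaq (F.P K) (K - (J + (t + 1))), ((∃ ℓ' : PBond (F.P (J + (t + 1))) 0, (∃ z : Site (F.P (J + (t + 1))) 0,
                (B14.Eq22Determines.blockIter (t + 1) z = (bondShift (F.sitesPerDir_eq (m := F.m) (K := J) (j := 0) (m' := F.m) (K' := J + (t + 1)) (j' := t + 1) (by omega)) B).src ∨ B14.Eq22Determines.blockIter (t + 1) z = (bondShift (F.sitesPerDir_eq (m := F.m) (K := J) (j := 0) (m' := F.m) (K' := J + (t + 1)) (j' := t + 1) (by omega)) B).tgt) ∧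
                ∀ ν, (B10Eq27TorusAxialLog.rel z ℓ'.src ν).natAbs ≤ 2) ∧
        (blockOf q.src = blockOf (bondShift (F.sitesPerDir_eq (m := F.m) (K := J + (t + 1)) (j := 0) (m' := F.m) (K' := K) (j' := (K - (J + (t + 1)))) (by omega)) ℓ').src ∨ blockOf q.src = (blockOf (bondShift (F.sitesPerDir_eq (m := F.m) (K := J + (t + 1)) (j := 0) (m' := F.m) (K' := K) (j' := (K - (J + (t + 1)))) (by omega)) ℓ').src).shift (bondShift (F.sitesPerDir_eq (m := F.m) (K := J + (t + 1)) (j := 0) (m' := F.m) (K' := K) (j' := (K - (J + (t + 1)))) (by omega)) ℓ').dir))) ∧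
          (if (q.src q.μ - emb p.src q.μ).val < (F.P K).L then (1 : ℝ) else 0) *
          (∏ ι ∈ (Finset.univ.erase q.μ).erase q.ν, max 0 (1 - ((rel (emb p.src) q.src ι).natAbs : ℝ) / (F.P K).L)) *
          (if (q.src q.ν - emb p.src q.ν).val < (F.P K).L then (1 : ℝ) else 0) ≠ 0 ∧ p.μ = q.μ ∧ p.ν = q.ν) then dist1 ((GaugeField.plaqHol (Averaging.iter (fun k => blockAvg (P := F.P K) (j := k) ℰp) ((K - (J + (t + 1))) + 1) U₀) p)⁻¹ * GaugeField.plaqHol (Averaging.iter (fun k => blockAvg (P := F.P K) (j := k) ℰp) ((K - (J + (t + 1))) + 1) (fun ℓ => expPoint (ζ ℓ) * U₀ ℓ : GaugeField (F.P K) 0 (Matrix.specialUnitaryGroup (Fin 2) ℂ))) p) else 0)‖ ^ 2 + 1536 * (σ t + σ t) ^ 2 * ((1 + σ t ^ 2 / 3) * ‖(fun e : PBond (F.P K) ((K - (J + (t + 1))) + 1) => if (∃ q : Plaq (F.P K) (K - (J + (t + 1))), ((∃ ℓ' : PBond (F.P (J + (t + 1))) 0, (∃ z : Site (F.P (J + (t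 + 1))) 0,
                (B14.Eq22Determines.blockIter (t + 1) z = (bondShift (F.sitesPerDir_eq (m := F.m) (K := J) (j := 0) (m' := F.m) (K' := J + (t + 1)) (j' := t + 1) (by omega)) B).src ∨ B14.Eq22Determines.blockIter (t + 1) z = (bondShift (F.sitesPerDir_eq (m := F.m) (K := J) (j := 0) (m' := F.m) (K' := J + (t + 1)) (j' := t + 1) (by omega)) B).tgt) ∧
                ∀ ν, (B10Eq27TorusAxialLog.rel z ℓ'.src ν).natAbs ≤ 2) ∧
        (blockOf q.src = blockOf (bondShift (F.sitesPerDir_eq (m := F.m) (K := J + (t + 1)) (j := 0) (m' := F.m) (K' := K) (j' := (K - (J + (t + 1)))) (by omega)) ℓ').src ∨ blockOf q.src = (blockOf (bondShift (F.sitesPerDir_eq (m := F.m) (K := J + (t + 1)) (j := 0) (m' := F.m) (K' := K) (j' := (K - (J + (t + 1)))) (by omega)) ℓ').src).shift (bondShift (F.sitesPerDir_eq (m := F.m) (K := J + (t + 1)) (j := 0) (m' := F.m) (K' := K) (j' := (K - (J + (t + 1)))) (by omega)) ℓ').dir))) ∧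
          ((∃ y : Site (F.P K) ((K - (J + (t + 1))) + 1), (if (q.src q.μ - emb y q.μ).val < (F.P K).L then (1 : ℝ) else 0) *
          (∏ ι ∈ (Finset.univ.erase q.μ).erase q.ν, max 0 (1 - ((rel (emb y) q.src ι).natAbs : ℝ) / (F.P K).L)) *
          (if (q.src q.ν - emb y q.ν).val < (F.P K).L then (1 : ℝ) else 0) ≠ 0 ∧ (e = ⟨y, q.μ⟩ ∨ e = ⟨y.shift q.μ, q.ν⟩ ∨ e = ⟨y.shift q.ν, q.μ⟩ ∨ e = ⟨y, q.ν⟩)) ∨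
           (∃ b : PBond (F.P K) (K - (J + (t + 1))), (b = ⟨q.src, q.μ⟩ ∨ b = ⟨q.src.shift q.μ, q.ν⟩ ∨ b = ⟨q.src.shift q.ν, q.μ⟩ ∨ b = ⟨q.src, q.ν⟩) ∧ wt (K - (J + (t + 1))) b e ≠ 0))) then dist1 ((Averaging.iter (fun k => blockAvg (P := F.P K) (j := k) ℰp) ((K - (J + (t + 1))) + 1) (fun ℓ => expPoint (ζ ℓ) * U₀ ℓ : GaugeField (F.P K) 0 (Matrix.specialUnitaryGroup (Fin 2) ℂ))) e * ((Averaging.iter (fun k => blockAvg (P := F.P K) (j := k) ℰp) ((K - (J + (t + 1))) + 1) U₀) e)⁻¹) else 0)‖) ^ 2))) ^ 2 ≤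
        (((((F.P K).L : ℕ) : ℝ)⁻¹) ^ 2 * ((((F.P K).L : ℕ) : ℝ)⁻¹) ^ 2) * (4 * ‖(fun p : Plaq (F.P K) ((K - (J + (t + 1))) + 1) => if ∃ z₀ : Site (F.P K) 0, (B14.Eq22Determines.blockIter (K - J) z₀ = (bondShift (F.sitesPerDir_eq (m := F.m) (K := J) (j := 0) (m' := F.m) (K' := K) (j' := K - J) (by omega)) B).src ∨
            B14.Eq22Determines.blockIter (K - J) z₀ = (bondShift (F.sitesPerDir_eq (m := F.m) (K := J) (j := 0) (m' := F.m) (K' := K) (j' := K - J) (by omega)) B).tgt) ∧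
            ∀ κ, (rel (B14.Eq22Determines.blockIter ((K - (J + (t + 1))) + 1) z₀) p.src κ).natAbs ≤ 2 * F.L + 1 then dist1 ((GaugeField.plaqHol (Averaging.iter (fun k => blockAvg (P := F.P K) (j := k) ℰp) ((K - (J + (t + 1))) + 1) U₀) p)⁻¹ * GaugeField.plaqHol (Averaging.iter (fun k => blockAvg (P := F.P K) (j := k) ℰp) ((K - (J + (t + 1))) + 1) (fun ℓ => expPoint (ζ ℓ) * U₀ ℓ : GaugeField (F.P K) 0 (Matrix.specialUnitaryGroup (Fin 2) ℂ))) p) else 0)‖ ^ 2 + (1536 * (σM + σM) ^ 2 * (1 + σM ^ 2 / 3) ^ 2) * ‖(fun c : PBond (F.P (J + t)) 0 =>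
        if ∃ ℓ' : PBond (F.P (J + (t + 1))) 0, (∃ ℓ'' : PBond (F.P (J + (t + 1))) 0, (∃ z : Site (F.P (J + (t + 1))) 0,
                (B14.Eq22Determines.blockIter (t + 1) z = (bondShift (F.sitesPerDir_eq (m := F.m) (K := J) (j := 0) (m' := F.m) (K' := J + (t + 1)) (j' := t + 1) (by omega)) B).src ∨ B14.Eq22Determines.blockIter (t + 1) z = (bondShift (F.sitesPerDir_eq (m := F.m) (K := J) (j := 0) (m' := F.m) (K' := J + (t + 1)) (j' := t + 1) (by omega)) B).tgt) ∧
                ∀ ν, (B10Eq27TorusAxialLog.rel z ℓ''.src ν).natAbs ≤ 2) ∧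
                (blockOf ℓ'.src = (blockOf ℓ''.src).unshift ℓ''.dir ∨ blockOf ℓ'.src = blockOf ℓ''.src ∨ blockOf ℓ'.src = (blockOf ℓ''.src).shift ℓ''.dir)) ∧
                ∀ ν, (B10Eq27TorusAxialLog.rel ((siteShift (F.sitesPerDir_eq (m := F.m) (K := J + t) (j := 0) (m' := F.m) (K' := J + (t + 1)) (j' := 1) (by omega))).symm (blockOf ℓ'.src)) c.src ν).natAbs ≤ 3
        then logVec (su2Quat (descendTo F ℰp (J + t) K (by omega) (fun ℓ => expPoint (ζ ℓ) * U₀ ℓ : GaugeField (F.P K) 0 (Matrix.specialUnitaryGroup (Fin 2) ℂ)) c * (descendTo F ℰp (J + t) K (by omega) U₀ c)⁻¹)) else 0)‖ ^ 2) := by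
      intro B
      refine (sq_sqrt_rhoA_le (((F.P K).L : ℕ) : ℝ)⁻¹ _ _ (σ t) σM (hσ0 t) (hσM t)).trans ?_
      have hP := pow_le_pow_left₀ (norm_nonneg _) (rhoPpar_le_readCellParent U₀ ζ t ht B) 2
      have hM := pow_le_pow_left₀ (norm_nonneg _) (mCpar_le_parentBoxSup U₀ ζ wt hwt t ht B) 2
      nlinarith [mul_nonneg hLI (mul_nonneg hCS (sub_nonneg.mpr hM)), mul_nonneg hLI (sub_nonneg.mpr hP)]
    -- sum over `B`, then the (k2′) cover for the chord column
    have hsumB := Finset.sum_le_sum fun B (_ : B ∈ Finset.univ) => hB B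
    rw [← Finset.mul_sum, Finset.sum_add_distrib, ← Finset.mul_sum, ← Finset.mul_sum] at hsumB
    have hcov : ∑ B : PBond (F.P J) 0, ‖(fun c : PBond (F.P (J + t)) 0 =>
        if ∃ ℓ' : PBond (F.P (J + (t + 1))) 0, (∃ ℓ'' : PBond (F.P (J + (t + 1))) 0, (∃ z : Site (F.P (J + (t + 1))) 0,
                (B14.Eq22Determines.blockIter (t + 1) z = (bondShift (F.sitesPerDir_eq (m := F.m) (K := J) (j := 0) (m' := F.m) (K' := J + (t + 1)) (j' := t + 1) (by omega)) B).src ∨ B14.Eq22Determines.blockIter (t + 1) z = (bondShift (F.sitesPerDir_eq (m := F.m) (K := J) (j := 0) (m' := F.m) (K' := J + (t + 1)) (j' := t + 1) (by omega)) B).tgt) ∧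
                ∀ ν, (B10Eq27TorusAxialLog.rel z ℓ''.src ν).natAbs ≤ 2) ∧
                (blockOf ℓ'.src = (blockOf ℓ''.src).unshift ℓ''.dir ∨ blockOf ℓ'.src = blockOf ℓ''.src ∨ blockOf ℓ'.src = (blockOf ℓ''.src).shift ℓ''.dir)) ∧
                ∀ ν, (B10Eq27TorusAxialLog.rel ((siteShift (F.sitesPerDir_eq (m := F.m) (K := J + t) (j := 0) (m' := F.m) (K' := J + (t + 1)) (j' := 1) (by omega))).symm (blockOf ℓ'.src)) c.src ν).natAbs ≤ 3
        then logVec (su2Quat (descendTo F ℰp (J + t) K (by omega) (fun ℓ => expPoint (ζ ℓ) * U₀ ℓ : GaugeField (F.P K) 0 (Matrix.specialUnitaryGroup (Fin 2) ℂ)) c * (descendTo F ℰp (J + t) K (by omega) U₀ c)⁻¹)) else 0)‖ ^ 2 ≤ ((2 * (F.P J).d * (2 * (3 + 3) + 1) ^ (F.P J).d : ℕ) : ℝ) * ∑ B : PBond (F.P J) 0, ‖(fun ℓ' : PBond (F.P (J + t)) 0 =>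
              if ∃ z : Site (F.P (J + t)) 0,
                (B14.Eq22Determines.blockIter t z = (bondShift (F.sitesPerDir_eq (m := F.m) (K := J) (j := 0) (m' := F.m) (K' := J + t) (j' := t) (by omega)) B).src ∨ B14.Eq22Determines.blockIter t z = (bondShift (F.sitesPerDir_eq (m := F.m) (K := J) (j := 0) (m' := F.m) (K' := J + t) (j' := t) (by omega)) B).tgt) ∧
                ∀ ν, (B10Eq27TorusAxialLog.rel z ℓ'.src ν).natAbs ≤ 2
              then logVec (su2Quat (descendTo F ℰp (J + t) K (by omega) (fun ℓ => expPoint (ζ ℓ) * U₀ ℓ : GaugeField (F.P K) 0 (Matrix.specialUnitaryGroup (Fin 2) ℂ)) ℓ' * (descendTo F ℰp (J + t) K (by omega) U₀ ℓ')⁻¹)) else 0)‖ ^ 2 := by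
      simpa only using sum_sq_parentBoxSup_le_readSup (F := F) J t 3 (fun c : PBond (F.P (J + t)) 0 => logVec (su2Quat (descendTo F ℰp (J + t) K (by omega) (fun ℓ => expPoint (ζ ℓ) * U₀ ℓ : GaugeField (F.P K) 0 (Matrix.specialUnitaryGroup (Fin 2) ℂ)) c * (descendTo F ℰp (J + t) K (by omega) U₀ c)⁻¹)))
    have h2 := mul_le_mul_of_nonneg_left (mul_le_mul_of_nonneg_left hcov hCS) hLI
    calc (F.L : ℝ) ^ t * ∑ B : PBond (F.P J) 0, (Real.sqrt (((((F.P K).L : ℕ) : ℝ)⁻¹) ^ 2 * ((((F.P K).L : ℕ) : ℝ)⁻¹) ^ 2 * (4 * ‖(fun p : Plaq (F.P K) ((K - (J + (t + 1))) + 1) => if (∃ q : Plaq (F.P K) (K - (J + (t + 1))), ((∃ ℓ' : PBond (F.P (J + (t + 1))) 0, (∃ z : Site (F.P (J + (t + 1))) 0,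
                (B14.Eq22Determines.blockIter (t + 1) z = (bondShift (F.sitesPerDir_eq (m := F.m) (K := J) (j := 0) (m' := F.m) (K' := J + (t + 1)) (j' := t + 1) (by omega)) B).src ∨ B14.Eq22Determines.blockIter (t + 1) z = (bondShift (F.sitesPerDir_eq (m := F.m) (K := J) (j := 0) (m' := F.m) (K' := J + (t + 1)) (j' := t + 1) (by omega)) B).tgt) ∧
                ∀ ν, (B10Eq27TorusAxialLog.rel z ℓ'.src ν).natAbs ≤ 2) ∧
        (blockOf q.src = blockOf (bondShift (F.sitesPerDir_eq (m := F.m) (K := J + (t + 1)) (j := 0) (m' := F.m) (K' := K) (j' := (K - (J + (t + 1)))) (by omega)) ℓ').src ∨ blockOf q.src = (blockOf (bondShift (F.sitesPerDir_eq (m := F.m) (K := J + (t + 1)) (j := 0) (m' := F.m) (K' := K) (j' := (K - (J + (t + 1)))) (by omega)) ℓ').src).shift (bondShift (F.sitesPerDir_eq (m := F.m) (K := J + (t + 1)) (j := 0) (m' := F.m) (K' := K) (j' := (K - (J + (t + 1)))) (by omega)) ℓ').dir))) ∧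
          (if (q.src q.μ - emb p.src q.μ).val < (F.P K).L then (1 : ℝ) else 0) *
          (∏ ι ∈ (Finset.univ.erase q.μ).erase q.ν, max 0 (1 - ((rel (emb p.src) q.src ι).natAbs : ℝ) / (F.P K).L)) *
          (if (q.src q.ν - emb p.src q.ν).val < (F.P K).L then (1 : ℝ) else 0) ≠ 0 ∧ p.μ = q.μ ∧ p.ν = q.ν) then dist1 ((GaugeField.plaqHol (Averaging.iter (fun k => blockAvg (P := F.P K) (j := k) ℰp) ((K - (J + (t + 1))) + 1) U₀) p)⁻¹ * GaugeField.plaqHol (Averaging.iter (fun k => blockAvg (P := F.P K) (j := k) ℰp) ((K - (J + (t + 1))) + 1) (fun ℓ => expPoint (ζ ℓ) * U₀ ℓ : GaugeField (F.P K) 0 (Matrix.specialUnitaryGroup (Fin 2) ℂ))) p) else 0)‖ ^ 2 + 1536 * (σ t + σ t) ^ 2 * ((1 + σ t ^ 2 / 3) * ‖(fun e : PBond (F.P K) ((K - (J + (t + 1))) + 1) => if (∃ q : Plaq (F.P K) (K - (J + (t + 1))), ((∃ ℓ' : PBond (F.P (J + (t + 1))) 0, (∃ z : Site (F.P (J + (t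 + 1))) 0,
                (B14.Eq22Determines.blockIter (t + 1) z = (bondShift (F.sitesPerDir_eq (m := F.m) (K := J) (j := 0) (m' := F.m) (K' := J + (t + 1)) (j' := t + 1) (by omega)) B).src ∨ B14.Eq22Determines.blockIter (t + 1) z = (bondShift (F.sitesPerDir_eq (m := F.m) (K := J) (j := 0) (m' := F.m) (K' := J + (t + 1)) (j' := t + 1) (by omega)) B).tgt) ∧
                ∀ ν, (B10Eq27TorusAxialLog.rel z ℓ'.src ν).natAbs ≤ 2) ∧
        (blockOf q.src = blockOf (bondShift (F.sitesPerDir_eq (m := F.m) (K := J + (t + 1)) (j := 0) (m' := F.m) (K' := K) (j' := (K - (J + (t + 1)))) (by omega)) ℓ').src ∨ blockOf q.src = (blockOf (bondShift (F.sitesPerDir_eq (m := F.m) (K := J + (t + 1)) (j := 0) (m' := F.m) (K' := K) (j' := (K - (J + (t + 1)))) (by omega)) ℓ').src).shift (bondShift (F.sitesPerDir_eq (m := F.m) (K := J + (t + 1)) (j := 0) (m' := F.m) (K' := K) (j' := (K - (J + (t + 1)))) (by omega)) ℓ').dir))) ∧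
          ((∃ y : Site (F.P K) ((K - (J + (t + 1))) + 1), (if (q.src q.μ - emb y q.μ).val < (F.P K).L then (1 : ℝ) else 0) *
          (∏ ι ∈ (Finset.univ.erase q.μ).erase q.ν, max 0 (1 - ((rel (emb y) q.src ι).natAbs : ℝ) / (F.P K).L)) *
          (if (q.src q.ν - emb y q.ν).val < (F.P K).L then (1 : ℝ) else 0) ≠ 0 ∧ (e = ⟨y, q.μ⟩ ∨ e = ⟨y.shift q.μ, q.ν⟩ ∨ e = ⟨y.shift q.ν, q.μ⟩ ∨ e = ⟨y, q.ν⟩)) ∨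
           (∃ b : PBond (F.P K) (K - (J + (t + 1))), (b = ⟨q.src, q.μ⟩ ∨ b = ⟨q.src.shift q.μ, q.ν⟩ ∨ b = ⟨q.src.shift q.ν, q.μ⟩ ∨ b = ⟨q.src, q.ν⟩) ∧ wt (K - (J + (t + 1))) b e ≠ 0))) then dist1 ((Averaging.iter (fun k => blockAvg (P := F.P K) (j := k) ℰp) ((K - (J + (t + 1))) + 1) (fun ℓ => expPoint (ζ ℓ) * U₀ ℓ : GaugeField (F.P K) 0 (Matrix.specialUnitaryGroup (Fin 2) ℂ))) e * ((Averaging.iter (fun k => blockAvg (P := F.P K) (j := k) ℰp) ((K - (J + (t + 1))) + 1) U₀) e)⁻¹) else 0)‖) ^ 2))) ^ 2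
        ≤ (F.L : ℝ) ^ t * ((((((F.P K).L : ℕ) : ℝ)⁻¹) ^ 2 * ((((F.P K).L : ℕ) : ℝ)⁻¹) ^ 2) * (4 * ∑ B : PBond (F.P J) 0, ‖(fun p : Plaq (F.P K) ((K - (J + (t + 1))) + 1) => if ∃ z₀ : Site (F.P K) 0, (B14.Eq22Determines.blockIter (K - J) z₀ = (bondShift (F.sitesPerDir_eq (m := F.m) (K := J) (j := 0) (m' := F.m) (K' := K) (j' := K - J) (by omega)) B).src ∨
            B14.Eq22Determines.blockIter (K - J) z₀ = (bondShift (F.sitesPerDir_eq (m := F.m) (K := J) (j := 0) (m' := F.m) (K' := K) (j' := K - J) (by omega)) B).tgt) ∧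
            ∀ κ, (rel (B14.Eq22Determines.blockIter ((K - (J + (t + 1))) + 1) z₀) p.src κ).natAbs ≤ 2 * F.L + 1 then dist1 ((GaugeField.plaqHol (Averaging.iter (fun k => blockAvg (P := F.P K) (j := k) ℰp) ((K - (J + (t + 1))) + 1) U₀) p)⁻¹ * GaugeField.plaqHol (Averaging.iter (fun k => blockAvg (P := F.P K) (j := k) ℰp) ((K - (J + (t + 1))) + 1) (fun ℓ => expPoint (ζ ℓ) * U₀ ℓ : GaugeField (F.P K) 0 (Matrix.specialUnitaryGroup (Fin 2) ℂ))) p) else 0)‖ ^ 2 + (1536 * (σM + σM) ^ 2 * (1 + σM ^ 2 / 3) ^ 2) * (((2 * (F.P J).d * (2 * (3 + 3) + 1) ^ (F.P J).d : ℕ) : ℝ) * ∑ B : PBond (F.P J) 0, ‖(fun ℓ' : PBond (F.P (J + t)) 0 =>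
              if ∃ z : Site (F.P (J + t)) 0,
                (B14.Eq22Determines.blockIter t z = (bondShift (F.sitesPerDir_eq (m := F.m) (K := J) (j := 0) (m' := F.m) (K' := J + t) (j' := t) (by omega)) B).src ∨ B14.Eq22Determines.blockIter t z = (bondShift (F.sitesPerDir_eq (m := F.m) (K := J) (j := 0) (m' := F.m) (K' := J + t) (j' := t) (by omega)) B).tgt) ∧
                ∀ ν, (B10Eq27TorusAxialLog.rel z ℓ'.src ν).natAbs ≤ 2
              then logVec (su2Quat (descendTo F ℰp (J + t) K (by omega) (fun ℓ => expPoint (ζ ℓ) * U₀ ℓ : GaugeField (F.P K) 0 (Matrix.specialUnitaryGroup (Fin 2) ℂ)) ℓ' * (descendTo F ℰp (J + t) K (by omega) U₀ ℓ')⁻¹)) else 0)‖ ^ 2))) :=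
          mul_le_mul_of_nonneg_left (hsumB.trans (by nlinarith [h2])) hLt
      _ = _ := by ring
  -- STEP 2: sum over the levels
  have hsum := Finset.sum_le_sum hlev
  rw [← Finset.mul_sum, Finset.sum_add_distrib, ← Finset.mul_sum, ← Finset.mul_sum, ← Finset.mul_sum] at hsum
  -- STEP 3a: the chord column is `≤ L·S′` (px20's share, one level up)
  have hM := mShare_le hJK U₀ ζ hmate
  -- STEP 3b: the plaquette column is the (k1) budget ONE LEVEL UP: index shift `t = t′ + 1`, the `t = 0` term vanishes on the fibre
  have hshift : ∑ t ∈ Finset.range (K - J), (F.L : ℝ) ^ t * ∑ B : PBond (F.P J) 0, ‖(fun p : Plaq (F.P K) ((K - (J + (t + 1))) + 1) => if ∃ z₀ : Site (F.P K) 0, (B14.Eq22Determines.blockIter (K - J) z₀ = (bondShift (F.sitesPerDir_eq (m := F.m) (K := J) (j := 0) (m' := F.m) (K' := K) (j' := K - J) (by omega)) B).src ∨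
            B14.Eq22Determines.blockIter (K - J) z₀ = (bondShift (F.sitesPerDir_eq (m := F.m) (K := J) (j := 0) (m' := F.m) (K' := K) (j' := K - J) (by omega)) B).tgt) ∧
            ∀ κ, (rel (B14.Eq22Determines.blockIter ((K - (J + (t + 1))) + 1) z₀) p.src κ).natAbs ≤ 2 * F.L + 1 then dist1 ((GaugeField.plaqHol (Averaging.iter (fun k => blockAvg (P := F.P K) (j := k) ℰp) ((K - (J + (t + 1))) + 1) U₀) p)⁻¹ * GaugeField.plaqHol (Averaging.iter (fun k => blockAvg (P := F.P K) (j := k) ℰp) ((K - (J + (t + 1))) + 1) (fun ℓ => expPoint (ζ ℓ) * U₀ ℓ : GaugeField (F.P K) 0 (Matrix.specialUnitaryGroup (Fin 2) ℂ))) p) else 0)‖ ^ 2 ≤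
      (F.L : ℝ) * ∑ t ∈ Finset.range (K - J), (F.L : ℝ) ^ t * ∑ B : PBond (F.P J) 0, ‖(fun q : Plaq (F.P K) (K - (J + (t + 1))) =>
        if ∃ z₀ : Site (F.P K) 0, (blockIter (K - J) z₀ = (bondShift (F.sitesPerDir_eq (m := F.m) (K := J) (j := 0) (m' := F.m) (K' := K) (j' := K - J) (by omega)) B).src ∨
            blockIter (K - J) z₀ = (bondShift (F.sitesPerDir_eq (m := F.m) (K := J) (j := 0) (m' := F.m) (K' := K) (j' := K - J) (by omega)) B).tgt) ∧
            ∀ κ, (rel (blockIter (K - (J + (t + 1))) z₀) q.src κ).natAbs ≤ 2 * F.L + 1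
        then dist1 ((GaugeField.plaqHol (Averaging.iter (fun k => BlockAveraging.blockAvg (P := F.P K) (j := k) ℰp) (K - (J + (t + 1))) U₀) q)⁻¹ *
          GaugeField.plaqHol (Averaging.iter (fun k => BlockAveraging.blockAvg (P := F.P K) (j := k) ℰp) (K - (J + (t + 1)))
            (fun ℓ => expPoint (ζ ℓ) * U₀ ℓ : GaugeField (F.P K) 0 (Matrix.specialUnitaryGroup (Fin 2) ℂ))) q)
        else 0)‖ ^ 2 := by
    rcases Nat.eq_zero_or_pos (K - J) with h0 | hpos
    · simp [h0]
    · obtain ⟨n, hn⟩ : ∃ n, K - J = n + 1 := ⟨K - J - 1, by omega⟩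
      have hr : Finset.range (K - J) = Finset.range (n + 1) := by rw [hn]
      rw [hr, Finset.sum_range_succ']
      -- the `t = 0` term: the parent pair at height `(K−(J+1))+1 = K−J` coincides on the fibre
      have hVW : (Averaging.iter (fun k => blockAvg (P := F.P K) (j := k) ℰp) ((K - (J + (0 + 1))) + 1) (fun ℓ => expPoint (ζ ℓ) * U₀ ℓ : GaugeField (F.P K) 0 (Matrix.specialUnitaryGroup (Fin 2) ℂ))) = (Averaging.iter (fun k => blockAvg (P := F.P K) (j := k) ℰp) ((K - (J + (0 + 1))) + 1) U₀) := by
        rw [show K - (J + (0 + 1)) + 1 = K - J by omega]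
        exact iter_eq_of_descendTo_eq F hJK hmate
      have hzero : ∀ B : PBond (F.P J) 0, ‖(fun p : Plaq (F.P K) ((K - (J + (0 + 1))) + 1) => if ∃ z₀ : Site (F.P K) 0, (B14.Eq22Determines.blockIter (K - J) z₀ = (bondShift (F.sitesPerDir_eq (m := F.m) (K := J) (j := 0) (m' := F.m) (K' := K) (j' := K - J) (by omega)) B).src ∨
            B14.Eq22Determines.blockIter (K - J) z₀ = (bondShift (F.sitesPerDir_eq (m := F.m) (K := J) (j := 0) (m' := F.m) (K' := K) (j' := K - J) (by omega)) B).tgt) ∧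
            ∀ κ, (rel (B14.Eq22Determines.blockIter ((K - (J + (0 + 1))) + 1) z₀) p.src κ).natAbs ≤ 2 * F.L + 1 then dist1 ((GaugeField.plaqHol (Averaging.iter (fun k => blockAvg (P := F.P K) (j := k) ℰp) ((K - (J + (0 + 1))) + 1) U₀) p)⁻¹ * GaugeField.plaqHol (Averaging.iter (fun k => blockAvg (P := F.P K) (j := k) ℰp) ((K - (J + (0 + 1))) + 1) (fun ℓ => expPoint (ζ ℓ) * U₀ ℓ : GaugeField (F.P K) 0 (Matrix.specialUnitaryGroup (Fin 2) ℂ))) p) else 0)‖ = 0 := fun B =>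
        piSup_relPlaq_eq_zero_of_eq _ _ hVW _
      have h0 : (F.L : ℝ) ^ 0 * ∑ B : PBond (F.P J) 0, ‖(fun p : Plaq (F.P K) ((K - (J + (0 + 1))) + 1) => if ∃ z₀ : Site (F.P K) 0, (B14.Eq22Determines.blockIter (K - J) z₀ = (bondShift (F.sitesPerDir_eq (m := F.m) (K := J) (j := 0) (m' := F.m) (K' := K) (j' := K - J) (by omega)) B).src ∨
            B14.Eq22Determines.blockIter (K - J) z₀ = (bondShift (F.sitesPerDir_eq (m := F.m) (K := J) (j := 0) (m' := F.m) (K' := K) (j' := K - J) (by omega)) B).tgt) ∧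
            ∀ κ, (rel (B14.Eq22Determines.blockIter ((K - (J + (0 + 1))) + 1) z₀) p.src κ).natAbs ≤ 2 * F.L + 1 then dist1 ((GaugeField.plaqHol (Averaging.iter (fun k => blockAvg (P := F.P K) (j := k) ℰp) ((K - (J + (0 + 1))) + 1) U₀) p)⁻¹ * GaugeField.plaqHol (Averaging.iter (fun k => blockAvg (P := F.P K) (j := k) ℰp) ((K - (J + (0 + 1))) + 1) (fun ℓ => expPoint (ζ ℓ) * U₀ ℓ : GaugeField (F.P K) 0 (Matrix.specialUnitaryGroup (Fin 2) ℂ))) p) else 0)‖ ^ 2 = 0 := by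
        simp only [hzero]; simp
      -- the shifted terms: height `(K−(J+(t′+2)))+1 = K−(J+(t′+1))`
      have hterm : ∀ t ∈ Finset.range n, (F.L : ℝ) ^ (t + 1) * ∑ B : PBond (F.P J) 0, ‖(fun p : Plaq (F.P K) ((K - (J + (t + 1 + 1))) + 1) => if ∃ z₀ : Site (F.P K) 0, (B14.Eq22Determines.blockIter (K - J) z₀ = (bondShift (F.sitesPerDir_eq (m := F.m) (K := J) (j := 0) (m' := F.m) (K' := K) (j' := K - J) (by omega)) B).src ∨
            B14.Eq22Determines.blockIter (K - J) z₀ = (bondShift (F.sitesPerDir_eq (m := F.m) (K := J) (j := 0) (m' := F.m) (K' := K) (j' := K - J) (by omega)) B).tgt) ∧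
            ∀ κ, (rel (B14.Eq22Determines.blockIter ((K - (J + (t + 1 + 1))) + 1) z₀) p.src κ).natAbs ≤ 2 * F.L + 1 then dist1 ((GaugeField.plaqHol (Averaging.iter (fun k => blockAvg (P := F.P K) (j := k) ℰp) ((K - (J + (t + 1 + 1))) + 1) U₀) p)⁻¹ * GaugeField.plaqHol (Averaging.iter (fun k => blockAvg (P := F.P K) (j := k) ℰp) ((K - (J + (t + 1 + 1))) + 1) (fun ℓ => expPoint (ζ ℓ) * U₀ ℓ : GaugeField (F.P K) 0 (Matrix.specialUnitaryGroup (Fin 2) ℂ))) p) else 0)‖ ^ 2 =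
          (F.L : ℝ) * ((F.L : ℝ) ^ t * ∑ B : PBond (F.P J) 0, ‖(fun q : Plaq (F.P K) (K - (J + (t + 1))) =>
        if ∃ z₀ : Site (F.P K) 0, (blockIter (K - J) z₀ = (bondShift (F.sitesPerDir_eq (m := F.m) (K := J) (j := 0) (m' := F.m) (K' := K) (j' := K - J) (by omega)) B).src ∨
            blockIter (K - J) z₀ = (bondShift (F.sitesPerDir_eq (m := F.m) (K := J) (j := 0) (m' := F.m) (K' := K) (j' := K - J) (by omega)) B).tgt) ∧
            ∀ κ, (rel (blockIter (K - (J + (t + 1))) z₀) q.src κ).natAbs ≤ 2 * F.L + 1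
        then dist1 ((GaugeField.plaqHol (Averaging.iter (fun k => BlockAveraging.blockAvg (P := F.P K) (j := k) ℰp) (K - (J + (t + 1))) U₀) q)⁻¹ *
          GaugeField.plaqHol (Averaging.iter (fun k => BlockAveraging.blockAvg (P := F.P K) (j := k) ℰp) (K - (J + (t + 1)))
            (fun ℓ => expPoint (ζ ℓ) * U₀ ℓ : GaugeField (F.P K) 0 (Matrix.specialUnitaryGroup (Fin 2) ℂ))) q)
        else 0)‖ ^ 2) := by
        intro t htm
        have htn : t < n := Finset.mem_range.mp htm
        have hh : K - (J + (t + 1 + 1)) + 1 = K - (J + (t + 1)) := by omega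
        rw [hh]; ring
      rw [h0, add_zero, Finset.sum_congr rfl hterm, ← Finset.mul_sum]
      exact mul_le_mul_of_nonneg_left (Finset.sum_le_sum_of_subset_of_nonneg (Finset.range_mono (Nat.le_succ n))
        (fun t _ _ => mul_nonneg (by positivity) (Finset.sum_nonneg fun B _ => sq_nonneg _))) hLr
  have h3b := mul_le_mul_of_nonneg_left (hshift.trans (mul_le_mul_of_nonneg_left hPk1 hLr)) (mul_nonneg hLI (by norm_num : (0:ℝ) ≤ 4))
  have h3a := mul_le_mul_of_nonneg_left hM (mul_nonneg hLI (mul_nonneg hCS hCA3))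
  have hfin : (((((F.P K).L : ℕ) : ℝ)⁻¹) ^ 2 * ((((F.P K).L : ℕ) : ℝ)⁻¹) ^ 2) * 4 * ((F.L : ℝ) * (C_P * Real.exp (c * ∑ i ∈ Finset.range (K - J), (((5 * F.L : ℕ) : ℝ) ^ 2 / 4) * θ (K - i)) * (((F.L : ℝ)⁻¹) ^ (K - J) * ∑ ℓ : PBond (F.P K) 0, ‖ζ ℓ‖ ^ 2 +
                (F.L : ℝ) ^ (K - J) * ∑ p : Plaq (F.P K) 0,
                  (1 - reTr ((GaugeField.plaqHol U₀ p)⁻¹ * GaugeField.plaqHol (fun ℓ => expPoint (ζ ℓ) * U₀ ℓ : GaugeField (F.P K) 0 (Matrix.specialUnitaryGroup (Fin 2) ℂ)) p))) +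
      β_P * (∑ t ∈ Finset.range (K - J), (if ht : t < K - J then
          (F.L : ℝ) ^ t * ∑ B : PBond (F.P J) 0,
            ‖(fun ℓ' : PBond (F.P (J + (t + 1))) 0 =>
              if ∃ z : Site (F.P (J + (t + 1))) 0,
                (B14.Eq22Determines.blockIter (t + 1) z = (bondShift (F.sitesPerDir_eq (m := F.m) (K := J) (j := 0) (m' := F.m) (K' := J + (t + 1)) (j' := t + 1) (by omega)) B).src ∨ B14.Eq22Determines.blockIter (t + 1) z = (bondShift (F.sitesPerDir_eq (m := F.m) (K := J) (j := 0) (m' := F.m) (K' := J + (t + 1)) (j' := t + 1) (by omega)) B).tgt) ∧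
                ∀ ν, (B10Eq27TorusAxialLog.rel z ℓ'.src ν).natAbs ≤ 2
              then logVec (su2Quat (descendTo F ℰp (J + (t + 1)) K (by omega) (fun ℓ => expPoint (ζ ℓ) * U₀ ℓ : GaugeField (F.P K) 0 (Matrix.specialUnitaryGroup (Fin 2) ℂ)) ℓ' * (descendTo F ℰp (J + (t + 1)) K (by omega) U₀ ℓ')⁻¹)) else 0)‖ ^ 2
        else 0)))) +
      (((((F.P K).L : ℕ) : ℝ)⁻¹) ^ 2 * ((((F.P K).L : ℕ) : ℝ)⁻¹) ^ 2) * ((1536 * (σM + σM) ^ 2 * (1 + σM ^ 2 / 3) ^ 2) * ((2 * (F.P J).d * (2 * (3 + 3) + 1) ^ (F.P J).d : ℕ) : ℝ)) * ((F.L : ℝ) * (∑ t ∈ Finset.range (K - J), (if ht : t < K - J then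
          (F.L : ℝ) ^ t * ∑ B : PBond (F.P J) 0,
            ‖(fun ℓ' : PBond (F.P (J + (t + 1))) 0 =>
              if ∃ z : Site (F.P (J + (t + 1))) 0,
                (B14.Eq22Determines.blockIter (t + 1) z = (bondShift (F.sitesPerDir_eq (m := F.m) (K := J) (j := 0) (m' := F.m) (K' := J + (t + 1)) (j' := t + 1) (by omega)) B).src ∨ B14.Eq22Determines.blockIter (t + 1) z = (bondShift (F.sitesPerDir_eq (m := F.m) (K := J) (j := 0) (m' := F.m) (K' := J + (t + 1)) (j' := t + 1) (by omega)) B).tgt) ∧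
                ∀ ν, (B10Eq27TorusAxialLog.rel z ℓ'.src ν).natAbs ≤ 2
              then logVec (su2Quat (descendTo F ℰp (J + (t + 1)) K (by omega) (fun ℓ => expPoint (ζ ℓ) * U₀ ℓ : GaugeField (F.P K) 0 (Matrix.specialUnitaryGroup (Fin 2) ℂ)) ℓ' * (descendTo F ℰp (J + (t + 1)) K (by omega) U₀ ℓ')⁻¹)) else 0)‖ ^ 2
        else 0))) =
      ((((((F.P K).L : ℕ) : ℝ)⁻¹) ^ 2 * ((((F.P K).L : ℕ) : ℝ)⁻¹) ^ 2) * (4 * (F.L : ℝ)) * C_P) * Real.exp (c * ∑ i ∈ Finset.range (K - J), (((5 * F.L : ℕ) : ℝ) ^ 2 / 4) * θ (K - i)) * (((F.L : ℝ)⁻¹) ^ (K - J) * ∑ ℓ : PBond (F.P K) 0, ‖ζ ℓ‖ ^ 2 +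
                (F.L : ℝ) ^ (K - J) * ∑ p : Plaq (F.P K) 0,
                  (1 - reTr ((GaugeField.plaqHol U₀ p)⁻¹ * GaugeField.plaqHol (fun ℓ => expPoint (ζ ℓ) * U₀ ℓ : GaugeField (F.P K) 0 (Matrix.specialUnitaryGroup (Fin 2) ℂ)) p))) +
      ((((((F.P K).L : ℕ) : ℝ)⁻¹) ^ 2 * ((((F.P K).L : ℕ) : ℝ)⁻¹) ^ 2) * (4 * (F.L : ℝ) * β_P + (1536 * (σM + σM) ^ 2 * (1 + σM ^ 2 / 3) ^ 2) * ((2 * (F.P J).d * (2 * (3 + 3) + 1) ^ (F.P J).d : ℕ) : ℝ) * (F.L : ℝ))) * (∑ t ∈ Finset.range (K - J), (if ht : t < K - J then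
          (F.L : ℝ) ^ t * ∑ B : PBond (F.P J) 0,
            ‖(fun ℓ' : PBond (F.P (J + (t + 1))) 0 =>
              if ∃ z : Site (F.P (J + (t + 1))) 0,
                (B14.Eq22Determines.blockIter (t + 1) z = (bondShift (F.sitesPerDir_eq (m := F.m) (K := J) (j := 0) (m' := F.m) (K' := J + (t + 1)) (j' := t + 1) (by omega)) B).src ∨ B14.Eq22Determines.blockIter (t + 1) z = (bondShift (F.sitesPerDir_eq (m := F.m) (K := J) (j := 0) (m' := F.m) (K' := J + (t + 1)) (j' := t + 1) (by omega)) B).tgt) ∧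
                ∀ ν, (B10Eq27TorusAxialLog.rel z ℓ'.src ν).natAbs ≤ 2
              then logVec (su2Quat (descendTo F ℰp (J + (t + 1)) K (by omega) (fun ℓ => expPoint (ζ ℓ) * U₀ ℓ : GaugeField (F.P K) 0 (Matrix.specialUnitaryGroup (Fin 2) ℂ)) ℓ' * (descendTo F ℰp (J + (t + 1)) K (by omega) U₀ ℓ')⁻¹)) else 0)‖ ^ 2
        else 0)) := by ring
  linarith [hsum, h3a, h3b, hfin]

end Tower

end Summit.QuantumFields.YangMills.Theorems.FluctuationComparisonRegPrIntLS2BetaRhoAColumnBudget
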